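import Literature.Algebra.EuclideanLattices.DualGridProgram
import Literature.Algebra.EuclideanLattices.DualGridSolverAdapter
import Literature.Algebra.EuclideanLattices.DualGridGuesses
import Literature.Algebra.EuclideanLattices.MRLemma510Function
import Literature.Computability.Cryptography.SISOddPartMachine
import Literature.Computability.Cryptography.PeikertSamplerVecMachine
import Literature.Probability.Distributions.PseudoGaussianSamplerParams
import HarnessLib

/-!
# The `IncGDD` solver of MR07 Thm. 5.9 on integer lattices as a list program

Topic `Algebra/EuclideanLattices` (family `pqc`). The solver machine `Sol` that the machine-level
Lemma 5.10 loop of `MRLemma510Function/Machine/Law.lean` consumes (wire format `IncGDDInst`: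
`(n, U, V, tw, td, rn, rd, pad)`, lattice `L(U)`, answers read as coefficient rows `z` of `U`): ONE
attempt of Micciancio–Regev 2007, Thm. 5.9 (authors' version p. 22) for a RANDOM guess `(j, α)`,
run on the scaled lattice `Λ' = c_U · L(U)` of `DualGridSolverAdapter` through the attempt program of
`DualGridProgram`, with the integer fine grid `(1/N)ℤⁿ`, the coin-driven pseudo-Gaussian sampler
(`samplerVecOf`) and a `SIS` oracle `orun`. This file writes the solver as total functions on lists
and strings (what the machine of the sequel computes) and proves the bridge to the specification:

* `SolParams` (the constants at this security parameter: `q, m, βnum, βden, βhat, N₀, mₚ, Lg, lenBits, prec`);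
  `guessOf` (the guess from the first `Lg` coins), `alphaZ`;
* the data of the scaled instance: `BrowsOf` (rows of `B_U = invMatrix Uᵀ`), `cOf`, `DgOf`, `GcolsOf`,
  `SrowsOf` (`c V`), `TSrowsOf`, `NOf` (`N = N₀ · td · |α| · rd`), `ellOf`, `attDataOfJ`
  (= `attDataOf B_U N (c S) q`, `attDataOfJ_eq`); the width exponent `eOfJ` from the radius;
* `PGOf` (the pseudo-Gaussian parameters `std mₚ e` of a guess), `TshRow` (the shifts),
  `solCore` — the attempt on given random inputs (samples, boxes, oracle answer) and its answer row
  `answerRow = (u' · invMatrix U)/(c det(U)²)`, with **`solCore_eq`**: on faithful data it is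
  `vecL (answerOf U (uVec B_U N (c S) q K κ z))` (`Ks_eq_ofFn` for the shifted noises);
* `valRows`/`queryStr` — the `SIS` query string (`= SIS.encodeMatrix` of the query matrix,
  `queryStr_eq`); `readAns` — the oracle's answer read as `m` integers (`= List.ofFn ∘ decodeIntVec m`,
  `readAns_eq_ofFn_decodeIntVec`);
* `solRun P orun ocb n U V tw td rn rd w` — the whole solver on the instance fields and the coins `w`.

## References

* D. Micciancio, O. Regev, *Worst-case to average-case reductions based on Gaussian measures*,
  SIAM J. Comput. 37 (2007) 267–302; authors' version, Thm. 5.9 (the reduction, p. 22), Lemma 5.7,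
  Lemma 5.8, Def. 5.6.
-/

noncomputable section

open scoped Classical

namespace Literature.Algebra.EuclideanLattices

open Module Matrix Finset GSInverse Literature.Computability.Complexity Literature.Computability.Complexity.CodeFP
  Literature.Computability.Cryptography Literature.Computability.QuantumComplexity Literature.Probability.Distributions

namespace DualGrid

variable {n : ℕ}

/-! ### Parameters and the guess -/

/-- **The constants of the solver at one security parameter.** [folklore] -/
structure SolParams where
  /-- `SIS` modulus -/
  q : ℕ
  /-- number of `SIS` samples -/
  m : ℕ
  /-- numerator of `β` -/
  βnum : ℕ
  /-- denominator of `β` -/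
  βden : ℕ
  /-- `⌊β⌋` -/
  βhat : ℕ
  /-- base grid multiplier -/
  N₀ : ℕ
  /-- precision of the pseudo-Gaussian sampler -/
  mp : ℕ
  /-- coin bits for the guess -/
  Lg : ℕ
  /-- coin bits for guessing the oracle's coin count -/
  lenBits : ℕ
  /-- precision multiplier of the box length (`2^ℓ > prec · n m² dT`) -/
  prec : ℕ

/-- **The guess `(j, a)` read off the first `Lg` coins** (value modulo `m · 2βhat`). [cite: MicciancioRegev2007, Thm. 5.9 (step 1)] -/
def guessOf (P : SolParams) (w : List Bool) : ℕ × ℕ :=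
  ((bitsToNat (w.take P.Lg) % (P.m * (2 * P.βhat))) / (2 * P.βhat), (bitsToNat (w.take P.Lg) % (P.m * (2 * P.βhat))) % (2 * P.βhat))

/-- The guess `α` as an integer (`alphaOf` on naturals). [folklore] -/
def alphaZ (βhat a : ℕ) : ℤ := if a < βhat then ((a + 1 : ℕ) : ℤ) else -((a - βhat + 1 : ℕ) : ℤ)

/-- `alphaZ` is `alphaOf`. [folklore] -/
theorem alphaZ_eq (βhat : ℕ) (a : Fin (2 * βhat)) : alphaZ βhat a = alphaOf βhat a := rfl

/-! ### The data of the scaled instance -/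

/-- Rows of `B_U = invMatrix Uᵀ`. [folklore] -/
def BrowsOf (n : ℕ) (U : List (List ℤ)) : List (List ℤ) := transposeL n (invCols (transposeL n U))

/-- The scaling factor `c = (det U²)^{2n−2}` computed from `invDen U = det(U)²`. [folklore] -/
def cOf (n : ℕ) (U : List (List ℤ)) : ℤ := invDen U ^ (2 * n - 2)

/-- `Dg` of `B_U`. [folklore] -/
def DgOf (n : ℕ) (U : List (List ℤ)) : ℤ := invDen (BrowsOf n U)

/-- Columns of `G = invMatrix B_U`. [folklore] -/
def GcolsOf (n : ℕ) (U : List (List ℤ)) : List (List ℤ) := invCols (BrowsOf n U)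

/-- The scaled rows `c V`. [folklore] -/
def SrowsOf (n : ℕ) (U V : List (List ℤ)) : List (List ℤ) := V.map (smulL (cOf n U))

/-- Rows of `T_S` (`τⱼ = B sⱼ / Dg` as columns). [folklore] -/
def TSrowsOf (n : ℕ) (U V : List (List ℤ)) : List (List ℤ) :=
  transposeL n ((SrowsOf n U V).map fun s => edivL (mulVecL (BrowsOf n U) s) (DgOf n U))

/-- **The grid parameter `N = N₀ · td · |α| · rd`** (so that `t/α` lies on the grid, and `N` dominates
the radius' denominator). [folklore] -/
def NOf (P : SolParams) (td rd : ℕ) (α : ℤ) : ℕ := P.N₀ * td * α.natAbs * rd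

/-- **The box length `ℓ = size (prec · n m² dT)`** (so that `n dT/2^ℓ ≤ 1/(prec · m)`). [folklore] -/
def ellOf (prec n m : ℕ) (dT : ℤ) : ℕ := Nat.size (prec * n * m * m * dT.toNat)

/-- **The attempt data of the solver.** [folklore] -/
def attDataOfJ (P : SolParams) (n : ℕ) (U V : List (List ℤ)) (td rd : ℕ) (α : ℤ) : AttData :=
  ⟨n, BrowsOf n U, GcolsOf n U, DgOf n U, NOf P td rd α, SrowsOf n U V, invCols (TSrowsOf n U V),
    invDen (TSrowsOf n U V) * ((NOf P td rd α : ℤ) * DgOf n U), P.q⟩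

/-! ### The width of the attempt -/

/-- The integer `X = ⌊80 c² rn² N² βden² / (63 βnum² n rd²)⌋` (`4^e ≤ X` gives `s ≤ 2r'/(β√n)`, using `π < 63/20`). [folklore] -/
def XOfJ (P : SolParams) (n : ℕ) (c : ℤ) (rn rd N : ℕ) : ℕ :=
  (80 * c.natAbs ^ 2 * rn ^ 2 * N ^ 2 * P.βden ^ 2) / (63 * P.βnum ^ 2 * n * rd ^ 2)

/-- **The width exponent `e = ⌊log₂ X⌋/2`** (so `4^e ≤ X < 4^{e+1}`). [cite: MicciancioRegev2007, Thm. 5.9 (s = 2r/γ) — machine choice] -/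
def eOfJ (P : SolParams) (n : ℕ) (c : ℤ) (rn rd N : ℕ) : ℕ := Nat.log 2 (XOfJ P n c rn rd N) / 2

/-- **The pseudo-Gaussian parameter set of a guess: `std mₚ e`.** [folklore] -/
def PGOf (P : SolParams) (n : ℕ) (U : List (List ℤ)) (td rn rd : ℕ) (α : ℤ) : PGParams :=
  PGParams.std P.mp (eOfJ P n (cOf n U) rn rd (NOf P td rd α))

/-! ### The core: the attempt on given random inputs -/

/-- **The shifts of the guess**: `Tsh j = -(N₀ sign α) c · tw` (`= -(N/(td α)) · (c tw)`, so that
`Tsh j / N = -t'/α`), zero elsewhere. [cite: MicciancioRegev2007, Thm. 5.9 (step 1: tᵢ = −t/α for i = j)] -/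
def TshRow (P : SolParams) (n : ℕ) (c : ℤ) (tw : List ℤ) (rd : ℕ) (α : ℤ) (j i : ℕ) : List ℤ :=
  if i = j then smulL (-((P.N₀ : ℤ) * α.sign * rd) * c) tw else List.replicate n 0

/-- **The answer row** `z = (u' · invMatrix U)/(c · det(U)²)` of a candidate `u' ∈ Λ'`. [cite: Cohen1993, §2.6.3] -/
def answerRow (n : ℕ) (U : List (List ℤ)) (u : List ℤ) : List ℤ :=
  edivL (colCombL n (transposeL n (invCols U)) u) (cOf n U * invDen U)

/-- **The core of the solver**: from the samples `Xs` (the `m` noise vectors before shifting), the box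
vectors `κs` and the oracle's answer `z`, the answer row. [cite: MicciancioRegev2007, Thm. 5.9 (steps 2–4)] -/
def solCore (P : SolParams) (n : ℕ) (U V : List (List ℤ)) (tw : List ℤ) (td rd : ℕ) (j : ℕ) (α : ℤ)
    (Xs κs : List (List ℤ)) (z : List ℤ) : List ℤ :=
  answerRow n U ((attDataOfJ P n U V td rd α).uVecL
    ((List.range P.m).map fun i => addL (Xs.getD i []) (TshRow P n (cOf n U) tw rd α j i)) κs z)

/-- **The `SIS` query matrix entries** (row `i`, column `j'` = entry `i` of the query column of sample `j'`). [cite: MicciancioRegev2007, Lemma 5.8 (step 3)] -/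
def valRows (n m : ℕ) (aRows : List (List ℤ)) : List (List ℕ) :=
  (List.range n).map fun i => (List.range m).map fun j' => ((aRows.getD j' []).getD i 0).toNat

/-- **The query string** in the format of `SIS.encodeMatrix`. [cite: MicciancioRegev2007, Def. 5.3] -/
def queryStr (n m q : ℕ) (aRows : List (List ℤ)) : List Bool :=
  pairE natE (pairE natE (pairE natE (listE (listE natE)))) (n, (m, (q, valRows n m aRows)))

/-! ### Reading the oracle's answer -/

/-- **The oracle's answer read as a list of `m` integers**: the entries if both headers announce `m`,
else `0ᵐ` — the list form of the tree's total decoder `decodeIntVec m` (`readAns_eq_ofFn_decodeIntVec`;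
the same function as `Regev2009.GIVPPost.readVec`, restated to keep the import closure small).
[cite: AroraBarak2009, §0.1 (representations)] -/
def readAns (m : ℕ) (u : List Bool) : List ℤ :=
  if SIS.OddPartFP.hdrOf u = m ∧ SIS.OddPartFP.lenOf u = m then SIS.OddPartFP.entriesOf m u else List.replicate m 0

/-- `entriesOf k w` has `k` entries. [folklore] -/
theorem length_entriesOf' (k : ℕ) (w : List Bool) : (SIS.OddPartFP.entriesOf k w).length = k := by
  simp [SIS.OddPartFP.entriesOf]

/-- `readAns m u` has length `m`. [folklore] -/
theorem length_readAns (m : ℕ) (u : List Bool) : (readAns m u).length = m := by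
  rw [readAns]
  split_ifs
  · exact length_entriesOf' _ _
  · exact List.length_replicate

/-- **`readAns` is the tree's decoder**: `readAns m u = List.ofFn (decodeIntVec m u)`. [cite: AroraBarak2009, §0.1] -/
theorem readAns_eq_ofFn_decodeIntVec (m : ℕ) (u : List Bool) : readAns m u = List.ofFn (decodeIntVec m u) := by
  rw [readAns, SIS.OddPartFP.decodeIntVec_eq]
  split_ifs with h
  · apply List.ext_getElem (by simp [SIS.OddPartFP.entriesOf])
    intro i h₁ h₂
    rw [List.getElem_ofFn, List.getD_eq_getElem]
  · rw [Pi.zero_def, List.ofFn_const]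

/-! ### The whole solver on the fields of an instance and a coin string -/

/-- **The solver** on the instance fields `(n, U, V, tw, td, rn, rd)` and coins `w`, against the `SIS`
oracle `orun` whose coin count is bounded by `ocb`: guess; data; width; `n·m` pseudo-Gaussian samples
from consecutive coin chunks; shifts; box length `ℓ` and boxes from the next coins; query; a guess of
the oracle's coin count from the next `lenBits` coins (the device of `SISFunctionSolver.lean`), the
oracle call; candidate; answer row (code `rawE intE`). [cite: MicciancioRegev2007, Thm. 5.9 (the reduction, p. 22)] -/
def solRun (P : SolParams) (orun : List Bool → List Bool → List Bool) (ocb : ℕ → ℕ)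
    (n : ℕ) (U V : List (List ℤ)) (tw : List ℤ) (td rn rd : ℕ) (w : List Bool) : List Bool :=
  let j := (guessOf P w).1
  let α := alphaZ P.βhat (guessOf P w).2
  let c := cOf n U
  let N := NOf P td rd α
  let e := eOfJ P n c rn rd N
  let PG := PGParams.std P.mp e
  let cl := PG.coinLen
  let w₁ := w.drop P.Lg
  let Xall := samplerVecOf PG.ctx (n * P.m) cl w₁
  let Xs := (List.range P.m).map fun i => (Xall.drop (i * n)).take n
  let w₂ := w₁.drop (n * P.m * cl)
  let d := attDataOfJ P n U V td rd α
  let ell := ellOf P.prec n P.m (invDen (TSrowsOf n U V))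
  let κs := (List.range P.m).map fun i => (List.range n).map fun l => (bitsToNat ((w₂.drop ((i * n + l) * ell)).take ell) : ℤ)
  let Ks := (List.range P.m).map fun i => addL (Xs.getD i []) (TshRow P n c tw rd α j i)
  let qs := queryStr n P.m P.q (d.aRowsL Ks κs)
  let w₃ := w₂.drop (n * P.m * ell)
  let Lo := bitsToNat (w₃.take P.lenBits) % (ocb qs.length + 1)
  let ans := orun qs ((w₃.drop P.lenBits).take Lo)
  let z := readAns P.m ans
  rawE intE (solCore P n U V tw td rd j α Xs κs z)

/-! ### Agreement with the specification -/

section Agreement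

/-- Reading an `ofFn` list of lists. [folklore] -/
theorem getD_ofFn_lt {m : ℕ} (l : Fin m → List ℤ) {i : ℕ} (hi : i < m) : (List.ofFn l).getD i [] = l ⟨i, hi⟩ := by
  rw [List.getD_eq_getElem _ _ (by simpa using hi), List.getElem_ofFn]

/-- `transposeL n (rowsOf M) = rowsOf Mᵀ`. [folklore] -/
theorem transposeL_rowsOf (M : Matrix (Fin n) (Fin n) ℤ) : transposeL n (rowsOf M) = rowsOf M.transpose := by
  rw [rowsOf_eq_ofFn]; exact transposeL_ofFn (fun j => M j)

/-- The rows of `invMatrix T` are the transpose of `invCols`. [cite: Cohen1993, §2.6.3] -/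
theorem transposeL_invCols (T : Matrix (Fin n) (Fin n) ℤ) : transposeL n (invCols (rowsOf T)) = rowsOf (invMatrix T) := by
  refine List.ext_getElem (by simp) fun t h1 h2 => ?_
  simp only [transposeL, List.getElem_map, List.getElem_range]
  rw [getElem_rowsOf]
  change ((invCols (rowsOf T)).map fun c => c.getD t 0) = vecL (invMatrix T ⟨t, by simpa using h2⟩)
  refine list_eq_of_getD (n := n) (by simp) (by simp) fun k => ?_
  rw [List.getD_eq_getElem _ _ (by simp), List.getElem_map, getElem_invCols, getD_vecL, invMatrix_apply]

/-- `BrowsOf_rowsOf` (bookkeeping / agreement with the specification). [folklore] -/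
theorem BrowsOf_rowsOf (U : Matrix (Fin n) (Fin n) ℤ) : BrowsOf n (rowsOf U) = rowsOf (BU U) := by
  rw [BrowsOf, transposeL_rowsOf, transposeL_invCols]; rfl

/-- `cOf_rowsOf` (bookkeeping / agreement with the specification). [folklore] -/
theorem cOf_rowsOf {U : Matrix (Fin n) (Fin n) ℤ} (hU : U.det ≠ 0) : cOf n (rowsOf U) = cU U := by
  rw [cOf, invDen_eq_det_sq hU, ← pow_mul, cU]; congr 1; omega

/-- `DgOf_rowsOf` (bookkeeping / agreement with the specification). [folklore] -/
theorem DgOf_rowsOf (U : Matrix (Fin n) (Fin n) ℤ) : DgOf n (rowsOf U) = Dg (BU U) := by rw [DgOf, BrowsOf_rowsOf]; rfl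

/-- `GcolsOf_rowsOf` (bookkeeping / agreement with the specification). [folklore] -/
theorem GcolsOf_rowsOf (U : Matrix (Fin n) (Fin n) ℤ) : GcolsOf n (rowsOf U) = invCols (rowsOf (BU U)) := by rw [GcolsOf, BrowsOf_rowsOf]

/-- The scaled rows as a matrix of rows. [folklore] -/
def scaledRows (U V : Matrix (Fin n) (Fin n) ℤ) : Matrix (Fin n) (Fin n) ℤ := fun j => cU U • V j

/-- `SrowsOf_rowsOf` (bookkeeping / agreement with the specification). [folklore] -/
theorem SrowsOf_rowsOf {U : Matrix (Fin n) (Fin n) ℤ} (hU : U.det ≠ 0) (V : Matrix (Fin n) (Fin n) ℤ) :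
    SrowsOf n (rowsOf U) (rowsOf V) = rowsOf (scaledRows U V) := by
  rw [SrowsOf, cOf_rowsOf hU, rowsOf_eq_ofFn, rowsOf_eq_ofFn, List.map_ofFn]
  congr 1; funext j; exact smulL_vecL _ _

/-- `TSrowsOf_rowsOf` (bookkeeping / agreement with the specification). [folklore] -/
theorem TSrowsOf_rowsOf {U : Matrix (Fin n) (Fin n) ℤ} (hU : U.det ≠ 0) (V : Matrix (Fin n) (Fin n) ℤ) :
    TSrowsOf n (rowsOf U) (rowsOf V) = rowsOf (TS (BU U) (scaledRows U V)) := by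
  rw [TSrowsOf, SrowsOf_rowsOf hU, BrowsOf_rowsOf, DgOf_rowsOf, rowsOf_eq_ofFn (scaledRows U V), List.map_ofFn]
  have h : ((fun s => edivL (mulVecL (rowsOf (BU U)) s) (Dg (BU U))) ∘ fun j => vecL (scaledRows U V j)) =
      fun j => vecL (tauVec (BU U) (scaledRows U V) j) := by
    funext j; simp only [Function.comp_apply, mulVecL_rowsOf, edivL_vecL]; rfl
  rw [h, transposeL_ofFn]; rfl

/-- **The solver's attempt data is the faithful data of `(B_U, N, c S, q)`.** [folklore] -/
theorem attDataOfJ_eq (P : SolParams) {U : Matrix (Fin n) (Fin n) ℤ} (hU : U.det ≠ 0) (V : Matrix (Fin n) (Fin n) ℤ) (td rd : ℕ) (α : ℤ) :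
    attDataOfJ P n (rowsOf U) (rowsOf V) td rd α = attDataOf (BU U) (NOf P td rd α) (scaledRows U V) P.q := by
  rw [attDataOfJ, attDataOf, BrowsOf_rowsOf, GcolsOf_rowsOf, DgOf_rowsOf, SrowsOf_rowsOf hU, TSrowsOf_rowsOf hU]
  rfl

/-- **The answer row is `answerOf`.** [folklore] -/
theorem answerRow_rowsOf {U : Matrix (Fin n) (Fin n) ℤ} (hU : U.det ≠ 0) (u : Fin n → ℤ) :
    answerRow n (rowsOf U) (vecL u) = vecL (answerOf U u) := by
  rw [answerRow, transposeL_invCols, rowsOf_eq_ofFn, colCombL_ofFn, cOf_rowsOf hU, invDen_eq_det_sq hU, edivL_vecL]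
  rfl

/-- The shift rows are the lists of the shift vectors. [folklore] -/
theorem TshRow_vecL (P : SolParams) (c : ℤ) (tw : Fin n → ℤ) (rd : ℕ) (α : ℤ) (j i : ℕ) :
    TshRow P n c (vecL tw) rd α j i = vecL (if i = j then (-((P.N₀ : ℤ) * α.sign * rd) * c) • tw else 0) := by
  unfold TshRow
  split_ifs
  · exact smulL_vecL _ _
  · exact (list_eq_of_getD (n := n) (by simp) (by simp) fun t => by
      rw [getD_vecL, List.getD_eq_getElem _ _ (by simp), List.getElem_replicate]; rfl)

variable {m : ℕ}

/-- **The shifted noise rows as a list**: `Ks = ofFn (vecL (X i + Tsh i))`. [folklore] -/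
theorem Ks_eq_ofFn (P : SolParams) (hm : P.m = m) (c : ℤ) (tw : Fin n → ℤ) (rd j : ℕ) (α : ℤ) (Xf : Fin m → Fin n → ℤ) :
    ((List.range P.m).map fun i => addL ((List.ofFn fun i => vecL (Xf i)).getD i []) (TshRow P n c (vecL tw) rd α j i)) =
      List.ofFn fun i : Fin m => vecL (Xf i + (if (i : ℕ) = j then (-((P.N₀ : ℤ) * α.sign * rd) * c) • tw else 0)) := by
  rw [hm]
  refine List.ext_getElem (by simp) fun i h1 h2 => ?_
  have hi : i < m := by simpa using h2
  rw [List.getElem_map, List.getElem_range, List.getElem_ofFn, getD_ofFn_lt _ hi, TshRow_vecL, addL_vecL]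

/-- **The core computes `answerOf U (uVec …)`**: with faithful lists of the samples `X`, boxes `κ`,
answer `z` and target numerator `tw`, on a nonsingular `U`, for parameters with `P.m = m`.
[cite: MicciancioRegev2007, Thm. 5.9 (steps 2–4) with Def. 5.6 (answers as coefficient rows)] -/
theorem solCore_eq (P : SolParams) (hm : P.m = m) {U : Matrix (Fin n) (Fin n) ℤ} (hU : U.det ≠ 0) (V : Matrix (Fin n) (Fin n) ℤ)
    (tw : Fin n → ℤ) (td rd j : ℕ) (α : ℤ) (Xf κf : Fin m → Fin n → ℤ) (zf : Fin m → ℤ) :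
    solCore P n (rowsOf U) (rowsOf V) (vecL tw) td rd j α (List.ofFn fun i => vecL (Xf i)) (List.ofFn fun i => vecL (κf i)) (vecL zf) =
      vecL (answerOf U (uVec (BU U) (NOf P td rd α) (scaledRows U V) P.q
        (fun i => Xf i + (if (i : ℕ) = j then (-((P.N₀ : ℤ) * α.sign * rd) * cU U) • tw else 0)) κf zf)) := by
  rw [solCore, cOf_rowsOf hU, Ks_eq_ofFn P hm, attDataOfJ_eq P hU, uVecL_eq, answerRow_rowsOf hU]

/-! ### The query string is `SIS.encodeMatrix` of the query matrix -/

/-- The query rows read as naturals are the residues' representatives. [folklore] -/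
theorem valRows_eq {q : ℕ} (hq : 0 < q) (B : Matrix (Fin n) (Fin n) ℤ) (N : ℕ) (S : Matrix (Fin n) (Fin n) ℤ) (Kf κf : Fin m → Fin n → ℤ) :
    valRows n m (List.ofFn fun i => vecL fun j => aEnt B N S q (Kf i) (κf i) j) =
      List.ofFn fun i : Fin n => List.ofFn fun j' : Fin m => ((Amat B N S q Kf κf) i j').val := by
  refine List.ext_getElem (by simp [valRows]) fun i h1 h2 => ?_
  simp only [valRows, List.getElem_map, List.getElem_range, List.getElem_ofFn]
  refine List.ext_getElem (by simp) fun j' h3 h4 => ?_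
  simp only [List.getElem_map, List.getElem_range, List.getElem_ofFn]
  have hj' : j' < m := by simpa using h3
  rw [getD_ofFn_lt _ hj', getD_vecL_nat _ (by simpa [valRows] using h1)]
  simp only [Amat, Matrix.of_apply]
  have h0 : 0 ≤ aEnt B N S q (Kf ⟨j', by simpa using h3⟩) (κf ⟨j', by simpa using h3⟩) ⟨i, by simpa [valRows] using h1⟩ :=
    Int.emod_nonneg _ (by exact_mod_cast hq.ne')
  have hlt : aEnt B N S q (Kf ⟨j', by simpa using h3⟩) (κf ⟨j', by simpa using h3⟩) ⟨i, by simpa [valRows] using h1⟩ < q :=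
    Int.emod_lt_of_pos _ (by exact_mod_cast hq)
  haveI : NeZero q := ⟨hq.ne'⟩
  have h : (((aEnt B N S q (Kf ⟨j', hj'⟩) (κf ⟨j', hj'⟩) ⟨i, by simpa [valRows] using h1⟩).toNat : ℕ) : ℤ) =
      ((((aEnt B N S q (Kf ⟨j', hj'⟩) (κf ⟨j', hj'⟩) ⟨i, by simpa [valRows] using h1⟩ : ℤ) : ZMod q).val : ℕ) : ℤ) := by
    rw [Int.toNat_of_nonneg h0, ZMod.val_intCast, Int.emod_eq_of_lt h0 hlt]
  exact_mod_cast h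

/-- **The query string is the tree's `SIS.encodeMatrix` of the query matrix `Amat`.** [cite: MicciancioRegev2007, Def. 5.3] -/
theorem queryStr_eq {q : ℕ} (hq : 0 < q) (B : Matrix (Fin n) (Fin n) ℤ) (N : ℕ) (S : Matrix (Fin n) (Fin n) ℤ) (Kf κf : Fin m → Fin n → ℤ) :
    queryStr n m q (List.ofFn fun i => vecL fun j => aEnt B N S q (Kf i) (κf i) j) = SIS.encodeMatrix (Amat B N S q Kf κf) := by
  rw [queryStr, valRows_eq hq, SIS.encodeMatrix]
  simp only [pairE_apply, ← natE_eq]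
  congr 3
  have e1 : (encodingFinVec _root_.Computability.encodingNatBool m).encode = fun v : Fin m → ℕ => listE natE (List.ofFn v) := by
    funext v
    change _root_.Computability.encodingNatBool.listBool.encode (List.ofFn v) = _
    rw [listE_eq]; rfl
  change _ = (encodingFinVec _root_.Computability.encodingNatBool m).listBool.encode (List.ofFn fun i j => (Amat B N S q Kf κf i j).val)
  rw [listE_eq, e1]
  simp only [listE, rawE, List.map_ofFn, List.length_ofFn]
  congr 3
  funext i
  simp only [Function.comp_apply, listE, rawE, List.map_ofFn, List.length_ofFn]
  rfl

end Agreement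

end DualGrid

end Literature.Algebra.EuclideanLattices

end
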